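import Mathlib
import HarnessLib

/-!
# ℤ9 SPECIMEN (peeled `𝔸⁴/ℤ9`, char 3), brick Z4b part 4d: the orbit-norm factors of `x_c²⁸` under the terminal
# substitution (the `hr₁`/`hr₂`/`hw`/`hw0` inputs of parts 4b/4c for res-D-pv-033's `normT 23`)

(crux stmt-ResolutionOfSingularities-15640 `WildQuotients.WildQuotientResolution`, line `Sketch`; S1 =
stmt-ResolutionOfSingularities-17941 `CyclicQuotientFourfolds`; chain w45c card-P specimen «peeled 𝔸⁴/ℤ9», variant
V-BR, brick Z4b part 4 (design `L/res-L1-w45c-stub-3/Z4B-PART4-DESIGN.md`). [OURS · L1 W4.5c] — NOT a statement of any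
manuscript; AI-produced. Def-free, Mathlib only; letters of Z0 (`σ̄` laws `hb hc`) and `…Z9PeeledTerminalLift` (`tm₂`).)

* `term_sigma_X_c_pow` — `ψ₂ (σ̄ x_c)²⁸ = s²⁸ v²⁸` (any characteristic);
* `term_sigma_sigma_X_c_pow` — `ψ₂ (σ̄² x_c)²⁸ = s²⁸ v'²⁸` (characteristic 3: `σ̄² x_c = x_c − x_b + x_a`);
* `sigma_orbitNorm_eq` — `σ̄ (x · σ̄x · σ̄²x) = x · σ̄x · σ̄²x` whenever `σ̄³ x = x`;
* `term_orbitNorm_X_c_pow_ne_zero` — `ψ₂ (x_c²⁸ · σ̄x_c²⁸ · σ̄²x_c²⁸) ≠ 0`.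
-/

-- single-problem summit: the doubled namespace component `ResolutionOfSingularities` is forced
set_option linter.dupNamespace false

noncomputable section

open MvPolynomial

namespace Summit.ResolutionOfSingularities.ResolutionOfSingularities.Theorems.WildQuotientResolution.Z9Peeled.Terminal

variable (k : Type) [Field k] (n : ℕ) (a b c d : Fin n)

/-- `v = 1 + s³ x_b′` (slots `s = X c`, `x_b′ = X b`; local shorthand). -/
local notation3 "v₂" => (1 + X c ^ 3 * X b : MvPolynomial (Fin n) k)
/-- `v' = 1 − s³ x_b′ + s⁶ x_a′` (local shorthand). -/
local notation3 "v₂'" => (1 - X c ^ 3 * X b + X c ^ 6 * X a : MvPolynomial (Fin n) k)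
/-- `u₂ = v v'` expanded (local shorthand; the element inverted on the terminal piece). -/
local notation3 "u₂" => ((1 + X c ^ 3 * X b) * (1 - X c ^ 3 * X b + X c ^ 6 * X a) : MvPolynomial (Fin n) k)
/-- The terminal chart ring `L₂ = k[x][(v v')⁻¹]` (local shorthand). -/
local notation3 "L₂" => Localization.Away
  ((1 + X c ^ 3 * X b) * (1 - X c ^ 3 * X b + X c ^ 6 * X a) : MvPolynomial (Fin n) k)
/-- `ι : k[x] → L₂` (local shorthand). -/
local notation3 "ι₂" => algebraMap (MvPolynomial (Fin n) k) (Localization.Away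
  ((1 + X c ^ 3 * X b) * (1 - X c ^ 3 * X b + X c ^ 6 * X a) : MvPolynomial (Fin n) k))
/-- `J = (v v')⁻¹ ∈ L₂` (local shorthand). -/
local notation3 "J₂" => (IsLocalization.Away.invSelf
  ((1 + X c ^ 3 * X b) * (1 - X c ^ 3 * X b + X c ^ 6 * X a) : MvPolynomial (Fin n) k) :
  Localization.Away ((1 + X c ^ 3 * X b) * (1 - X c ^ 3 * X b + X c ^ 6 * X a) : MvPolynomial (Fin n) k))
/-- `iv = (ι v)⁻¹ = ι v' · J` (local shorthand). -/
local notation3 "iv₂" => (algebraMap (MvPolynomial (Fin n) k) (Localization.Away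
  ((1 + X c ^ 3 * X b) * (1 - X c ^ 3 * X b + X c ^ 6 * X a) : MvPolynomial (Fin n) k))
    (1 - X c ^ 3 * X b + X c ^ 6 * X a) *
  (IsLocalization.Away.invSelf
    ((1 + X c ^ 3 * X b) * (1 - X c ^ 3 * X b + X c ^ 6 * X a) : MvPolynomial (Fin n) k) :
    Localization.Away ((1 + X c ^ 3 * X b) * (1 - X c ^ 3 * X b + X c ^ 6 * X a) : MvPolynomial (Fin n) k)))
/-- `iv' = (ι v')⁻¹ = ι v · J` (local shorthand). -/
local notation3 "iv₂'" => (algebraMap (MvPolynomial (Fin n) k) (Localization.Away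
  ((1 + X c ^ 3 * X b) * (1 - X c ^ 3 * X b + X c ^ 6 * X a) : MvPolynomial (Fin n) k))
    (1 + X c ^ 3 * X b) *
  (IsLocalization.Away.invSelf
    ((1 + X c ^ 3 * X b) * (1 - X c ^ 3 * X b + X c ^ 6 * X a) : MvPolynomial (Fin n) k) :
    Localization.Away ((1 + X c ^ 3 * X b) * (1 - X c ^ 3 * X b + X c ^ 6 * X a) : MvPolynomial (Fin n) k)))
/-- The terminal substitution `ψ₂` (local shorthand): `x_a ↦ x_a′ s⁷`, `x_b ↦ x_b′ s⁴`, rest fixed. -/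
local notation3 "tm₂" => (fun i : Fin n => if i = a then X a * X c ^ 7
    else if i = b then X b * X c ^ 4 else (X i : MvPolynomial (Fin n) k))


variable (σ : MvPolynomial (Fin n) k ≃ₐ[k] MvPolynomial (Fin n) k)
  (hb : σ (X b) = X b + X a) (hc : σ (X c) = X c + X b)

include hc in
/-- `ψ₂ ((σ̄ x_c)²⁸) = s²⁸ · v²⁸` (`σ̄ x_c = x_c + x_b ↦ s + x_b′s⁴ = s·v`). [OURS · L1 W4.5c] -/
theorem term_sigma_X_c_pow (hab : a ≠ b) (hac : a ≠ c) (hbc : b ≠ c) (m : ℕ) :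
    aeval tm₂ (σ (X c ^ m)) = X c ^ m * v₂ ^ m := by
  have hrb : aeval tm₂ (X b : MvPolynomial (Fin n) k) = X b * X c ^ 4 := by
    rw [aeval_X]; simp [hab.symm]
  have hrc : aeval tm₂ (X c : MvPolynomial (Fin n) k) = X c := by
    rw [aeval_X]; simp [hac.symm, hbc.symm]
  rw [map_pow, hc, map_pow, map_add, hrb, hrc, ← mul_pow]
  congr 1
  ring

include hb hc in
/-- `ψ₂ ((σ̄² x_c)²⁸) = s²⁸ · v'²⁸` in characteristic `3` (`σ̄² x_c = x_c + 2x_b + x_a = x_c − x_b + x_a ↦ s·v'`).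
[OURS · L1 W4.5c] -/
theorem term_sigma_sigma_X_c_pow [CharP k 3] (hab : a ≠ b) (hac : a ≠ c) (hbc : b ≠ c) (m : ℕ) :
    aeval tm₂ (σ (σ (X c ^ m))) = X c ^ m * v₂' ^ m := by
  have hra : aeval tm₂ (X a : MvPolynomial (Fin n) k) = X a * X c ^ 7 := by rw [aeval_X]; simp
  have hrb : aeval tm₂ (X b : MvPolynomial (Fin n) k) = X b * X c ^ 4 := by
    rw [aeval_X]; simp [hab.symm]
  have hrc : aeval tm₂ (X c : MvPolynomial (Fin n) k) = X c := by
    rw [aeval_X]; simp [hac.symm, hbc.symm]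
  have h3 : (3 : MvPolynomial (Fin n) k) = 0 := by
    have := CharP.cast_eq_zero (MvPolynomial (Fin n) k) 3
    simpa using this
  rw [map_pow, map_pow, hc, map_add, hc, hb, map_pow]
  simp only [map_add, hra, hrb, hrc]
  rw [← mul_pow]
  congr 1
  linear_combination (X b * X c ^ 4) * h3

/-- **The orbit norm of an element of `σ̄`-order `3` is `σ̄`-invariant**: `σ̄ (x·σ̄x·σ̄²x) = x·σ̄x·σ̄²x` if `σ̄³ x = x`.
[folklore] -/
theorem sigma_orbitNorm_eq (x : MvPolynomial (Fin n) k) (h3 : σ (σ (σ x)) = x) :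
    σ (x * σ x * σ (σ x)) = x * σ x * σ (σ x) := by
  rw [map_mul, map_mul, h3]; ring

include hb hc in
/-- `ψ₂ (x_c^m · σ̄x_c^m · σ̄²x_c^m) ≠ 0` (a product of non-zero polynomials; characteristic `3` form). [folklore] -/
theorem term_orbitNorm_X_c_pow_ne_zero [CharP k 3] (hab : a ≠ b) (hac : a ≠ c) (hbc : b ≠ c) (m : ℕ) :
    aeval tm₂ (X c ^ m * σ (X c ^ m) * σ (σ (X c ^ m))) ≠ 0 := by
  classical
  have hrc : aeval tm₂ (X c : MvPolynomial (Fin n) k) = X c := by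
    rw [aeval_X]; simp [hac.symm, hbc.symm]
  have hu0 : u₂ ≠ 0 := by
    intro h
    have h' := congrArg MvPolynomial.constantCoeff h
    simp [MvPolynomial.constantCoeff_X] at h'
  have hv0 : v₂ ≠ 0 := fun h => hu0 (by rw [show u₂ = v₂ * v₂' from rfl, h, zero_mul])
  have hv'0 : v₂' ≠ 0 := fun h => hu0 (by rw [show u₂ = v₂ * v₂' from rfl, h, mul_zero])
  rw [map_mul, map_mul, term_sigma_X_c_pow k n a b c σ hc hab hac hbc,
    term_sigma_sigma_X_c_pow k n a b c σ hb hc hab hac hbc, map_pow, hrc]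
  exact mul_ne_zero (mul_ne_zero (pow_ne_zero _ (X_ne_zero c))
    (mul_ne_zero (pow_ne_zero _ (X_ne_zero c)) (pow_ne_zero _ hv0)))
    (mul_ne_zero (pow_ne_zero _ (X_ne_zero c)) (pow_ne_zero _ hv'0))

end Summit.ResolutionOfSingularities.ResolutionOfSingularities.Theorems.WildQuotientResolution.Z9Peeled.Terminal

end
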